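import Mathlib
import HarnessLib
import Literature.MathematicalPhysics.QuantumLattice.GrassmannDeepPinBinomial
import Summits.HubbardSuperconductivity.HubbardSuperconductivity.Theorems.KLProgrammeKLRegimeTwoVolumeLipDeepStep

/-!
# Route `KLProgramme` — crux K3 ENGINE (stmt-HubbardSuperconductivity-20437), stub (e) proof-input «(e)-D-ROWS», (M3): THE TWO-VOLUME LIPSCHITZ BLOCK STEP
# AT A DEEP PIN, `(f, g)`-READING — the FIRST ORDER, and the whole BORN DIFFERENCE (first order + orders `≥ 2`) in one door (seat hubbard-kl-k3c4-p1 g23;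
# `--supports` 20437; DROWS-SCOPE-g22 §7.2 (i)–(iii), §8.1)

Companion of `…TwoVolumeLipDeepStep` (p700426, orders `≥ 2`).  Same reading: inputs `V` (glued coarse analysed action) and `V + D` (fine analysed action) on the
INPUT labels `Γ′` (tree weight `wt`, deep region `P`), Gaussian step on `Γ` at the covariance `C` after the substitution `f` (the doors see the pulled-back
covariance `fᵀCf`, `Lit/GrassmannLinearSubstitution.gaussConv_map / effAction_map`), output read through `g` at ONE output pin `w″` whose row of `h = g∘f` splits
into a NEAR part (deep input pins, total `≤ a`) and a FAR tail (`≤ τ`).  The first order of the born difference is LINEAR in `D`: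
`(e^{Δ_C}(f(V+D)) − f(V+D)) − (e^{Δ_C}(fV) − fV) = f(e^{Δ_{fᵀCf}} D − D)`; on `Γ′` it is deep-small by `Lit/GrassmannDeepPinBinomial` (support split + binomial–Gram
door + its zone form, `Λ` admissible at every near pin) and globally bounded by the binomial–Gram door at the global (unweighted) profile; the pushforward
`…TwoVolumeSubstitutionPushforward.sum_pinned_norm_kernel_map_le_of_near` combines the two:

* `binomialRHS_nonneg`, `sum_pinned_norm_kernel_map_le_of_near_deg` (the pushforward in a general degree `m`, factor `a^{m−1}`);
* **`sum_pinned_norm_kernel_map_gaussConv_sub_le_of_deep`** (§1, first order) —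
  `Σ_{X″ : X″_i = w″} ‖kernel_{2q} (map g (e^{Δ_C}(map f D) − map f D))(X″)‖ ≤ a^{2q−1}·(a·(BG(E) + Λ⁻¹·BG(N_D)) + τ·BG(N_D))`,
  `BG(N) = Σ_{q<m'≤|Γ′|/2} C(2m',2q) κ^{2m'−2q} N(m')` (kit reading: E1's `doorBinomial_le_towerFO`, `σ := κ²`);
* `sum_pinned_norm_kernel_map_incr_sub_incr_le_of_deep_deg` (§2) — p700426 restated in a general output degree `m` (factor `a^{m−1}`);
* **`sum_pinned_norm_kernel_map_born_sub_born_le_of_deep`** (§3, THE DEEP BLOCK-STEP DOOR) — for the born increments `born_C Y := effAction C Y − Y`,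
  `Σ_{X″ : X″_i = w″} ‖kernel_{2q} (map g (born_C(map f (V+D)) − born_C(map f V)))(X″)‖ ≤ [first order, §1] + [orders ≥ 2, p700426 at degree 2q]` —
  the Grassmann-level form of the `hstep` hypothesis of E1's Lipschitz tower `EngineV8.towerBornDiff_le_law₄` (T3-Lip₄) at one deep output pin: `towerFO` ←
  `BG(E)`, the mixed graded sum + `Ct`-tail ← `GL(·; E)` (`…EngineTowerDoorToKitLip`), and the SOURCE `src` ← the `Λ⁻¹`-terms (zone bracket,
  `…TwoVolumeLipDoorToKit`, `…TwoVolumeLipZoneLaw`) + the `τ`-terms (transfer tails) + the covariance/frame sources added by the caller.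

NOT here: the model dictionary (F-D3′: `f = S(F̃_{J_k−1})`, `g = ε•E(F_{J′})`, `C` = the block covariance, `P`/`Near` = depth predicates of
`…TwoVolumeTorusBlocks`, `Λ = 1 + Λ_{J_{k+1}}(ρ_k+1)` by `…TwoVolumeLipZoneGeometry`), the kit/units reading.  Everything is proved; no definition.  Nothing about
the model is asserted; nothing asserts the (D) rows, stub (e), VL, K3 or superconductivity.  References: BGM 2006 (2.61)–(2.63), (2.77)–(2.90), §3
[cite: BenfattoGiulianiMastropietro2006]; Gawȩdzki–Kupiainen 1985 §3.
-/

noncomputable section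

namespace Summit.HubbardSuperconductivity.HubbardSuperconductivity.Theorems.TwoVolumeDefect

set_option linter.dupNamespace false -- summit = problem name (single-conjunct summit), D-0017

open Finset Literature.MathematicalPhysics.QuantumLattice GrassmannAlgebra Literature.Probability.LatticeModels
  Literature.Probability.LatticeModels.BattleFederbush

universe u

variable {𝕜 : Type*} [RCLike 𝕜]

/-! ## §0 Two small tools -/

/-- The binomial–Gram right side is nonnegative. -/
theorem binomialRHS_nonneg {κ : ℝ} (hκ : 0 ≤ κ) {N : ℕ → ℝ} (hN0 : ∀ m', 0 ≤ N m') (K q : ℕ) :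
    0 ≤ ∑ m' ∈ range K, (if q < m' then ((2 * m').choose (2 * q) : ℝ) * κ ^ (2 * m' - 2 * q) * N m' else 0) :=
  sum_nonneg fun m' _ => by
    split_ifs
    · exact mul_nonneg (mul_nonneg (Nat.cast_nonneg _) (pow_nonneg hκ _)) (hN0 m')
    · exact le_rfl

/-- `…SubstitutionPushforward.sum_pinned_norm_kernel_map_le_of_near` in a general (positive) degree `m`: `≤ a^{m−1}·(a·E + τ·ND)`. -/
theorem sum_pinned_norm_kernel_map_le_of_near_deg {Γ₁' Γ₂' : Type*} [Fintype Γ₁'] [DecidableEq Γ₁'] [Fintype Γ₂'] [DecidableEq Γ₂']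
    (T' : Matrix Γ₂' Γ₁' 𝕜) (D : GrassmannAlgebra 𝕜 Γ₁') {m : ℕ} (p : Fin m) (w' : Γ₂')
    (Near : Γ₁' → Prop) [DecidablePred Near] {a τ E ND : ℝ} (ha : 0 ≤ a) (hE0 : 0 ≤ E) (hND0 : 0 ≤ ND)
    (hcol : ∀ y', ∑ x', ‖T' x' y'‖ ≤ a) (hrow : ∑ y' ∈ univ.filter (fun y' : Γ₁' => Near y'), ‖T' w' y'‖ ≤ a)
    (hτ : ∑ y' ∈ univ.filter (fun y' : Γ₁' => ¬ Near y'), ‖T' w' y'‖ ≤ τ)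
    (hE : ∀ y', Near y' → ∑ Y' ∈ univ.filter (fun Y' : Fin m → Γ₁' => Y' p = y'), ‖kernel 𝕜 D m Y'‖ ≤ E)
    (hND : ∀ y', ∑ Y' ∈ univ.filter (fun Y' : Fin m → Γ₁' => Y' p = y'), ‖kernel 𝕜 D m Y'‖ ≤ ND) :
    ∑ X' ∈ univ.filter (fun X' : Fin m → Γ₂' => X' p = w'), ‖kernel 𝕜 (ExteriorAlgebra.map (Matrix.toLin' T') D) m X'‖ ≤
      a ^ (m - 1) * (a * E + τ * ND) := by
  obtain ⟨n, rfl⟩ : ∃ n, m = n + 1 := ⟨m - 1, by have := p.pos; omega⟩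
  rw [Nat.add_sub_cancel]
  exact sum_pinned_norm_kernel_map_le_of_near T' D p w' Near ha hE0 hND0 hcol hrow hτ hE hND

/-! ## §1 The first order at a deep pin, `(f,g)`-reading -/

/-- **THE FIRST ORDER OF THE TWO-VOLUME LIPSCHITZ BLOCK STEP AT A DEEP PIN, `(f,g)`-READING.**  Labels: `Γ′` (inputs; tree weight `wt`, deep region `P`),
`Γ` (the covariance `C`), `Γ″` (outputs); substitutions `f : (Γ′ → 𝕜) →ₗ (Γ → 𝕜)`, `g : (Γ → 𝕜) →ₗ (Γ″ → 𝕜)`, `h = g ∘ f` with column sums `≤ a`, and at the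
output pin `w″` a near part of its row (`Near ⊆ Γ′`, total `≤ a`) and a far tail `≤ τ`.  The pulled-back covariance `fᵀCf` is replica-Gram-bounded (constant
`κ ≥ 0`); `D` even on `Γ′` with `wt`-weighted pinned profile `N_D` and UNWEIGHTED profile at the pins of `P` at most `E`; `0 < Λ ≤ wt S` for every near pin
`y′`, every `S ∋ y′` meeting `Pᶜ`.  Then in every even output degree `2q`, slot `i` pinned at `w″`:
`Σ_{X″ : X″_i = w″} ‖kernel_{2q}(map g (e^{Δ_C}(map f D) − map f D))(X″)‖ ≤ a^{2q−1}·(a·(BG(E) + Λ⁻¹·BG(N_D)) + τ·BG(N_D))`,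
`BG(N) = Σ_{q<m'} C(2m',2q) κ^{2m'−2q} N(m')`. -/
theorem sum_pinned_norm_kernel_map_gaussConv_sub_le_of_deep
    {Γ : Type u} [Fintype Γ] [DecidableEq Γ] {Γ' : Type u} [Fintype Γ'] [DecidableEq Γ'] {Γ'' : Type*} [Fintype Γ''] [DecidableEq Γ'']
    {wt : Finset Γ' → ℝ} (hwt : IsTreeWeight wt) (C : Matrix Γ Γ 𝕜) (f : (Γ' → 𝕜) →ₗ[𝕜] (Γ → 𝕜)) (g : (Γ → 𝕜) →ₗ[𝕜] (Γ'' → 𝕜))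
    {κ : ℝ} (hκ : 0 ≤ κ) (hGB : IsGramBoundedR ((LinearMap.toMatrix' f).transpose * C * LinearMap.toMatrix' f) κ)
    (D : GrassmannAlgebra 𝕜 Γ') (hD : D ∈ evenPart 𝕜 Γ')
    (ND E : ℕ → ℝ) (hND0 : ∀ m', 0 ≤ ND m') (hE0 : ∀ m', 0 ≤ E m')
    (hND : ∀ m' (j : Fin (2 * m')) (x : Γ'), ∑ Y ∈ univ.filter (fun Y : Fin (2 * m') → Γ' => Y j = x),
      ‖kernel 𝕜 D (2 * m') Y‖ * wt (univ.image Y) ≤ ND m')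
    (P : Γ' → Prop) [DecidablePred P]
    (hE : ∀ m' (j : Fin (2 * m')) (x : Γ'), P x → ∑ Y ∈ univ.filter (fun Y : Fin (2 * m') → Γ' => Y j = x), ‖kernel 𝕜 D (2 * m') Y‖ ≤ E m')
    -- the substitution `h = g ∘ f` at the output pin
    (Near : Γ' → Prop) [DecidablePred Near] {a τ : ℝ} (ha : 0 ≤ a)
    (hcolH : ∀ y', ∑ x'', ‖LinearMap.toMatrix' (g ∘ₗ f) x'' y'‖ ≤ a) (w'' : Γ'')
    (hrowH : ∑ y' ∈ univ.filter (fun y' : Γ' => Near y'), ‖LinearMap.toMatrix' (g ∘ₗ f) w'' y'‖ ≤ a)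
    (hτH : ∑ y' ∈ univ.filter (fun y' : Γ' => ¬ Near y'), ‖LinearMap.toMatrix' (g ∘ₗ f) w'' y'‖ ≤ τ)
    {Λ : ℝ} (hΛ0 : 0 < Λ) (hΛ : ∀ y', Near y' → ∀ S : Finset Γ', y' ∈ S → (∃ z ∈ S, ¬ P z) → Λ ≤ wt S)
    {q : ℕ} (i : Fin (2 * q)) :
    ∑ X'' ∈ univ.filter (fun X'' : Fin (2 * q) → Γ'' => X'' i = w''),
        ‖kernel 𝕜 (ExteriorAlgebra.map g (gaussConv 𝕜 C (ExteriorAlgebra.map f D) - ExteriorAlgebra.map f D)) (2 * q) X''‖ ≤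
      a ^ (2 * q - 1) * (a *
        ((∑ m' ∈ range (Fintype.card Γ' / 2 + 1), if q < m' then ((2 * m').choose (2 * q) : ℝ) * κ ^ (2 * m' - 2 * q) * E m' else 0) +
          Λ⁻¹ * ∑ m' ∈ range (Fintype.card Γ' / 2 + 1),
            if q < m' then ((2 * m').choose (2 * q) : ℝ) * κ ^ (2 * m' - 2 * q) * ND m' else 0) +
        τ * ∑ m' ∈ range (Fintype.card Γ' / 2 + 1), if q < m' then ((2 * m').choose (2 * q) : ℝ) * κ ^ (2 * m' - 2 * q) * ND m' else 0) := by
  set C' : Matrix Γ' Γ' 𝕜 := (LinearMap.toMatrix' f).transpose * C * LinearMap.toMatrix' f with hC'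
  -- the first order lives on `Γ′`
  set X : GrassmannAlgebra 𝕜 Γ' := gaussConv 𝕜 C' D - D with hX
  have hsub : gaussConv 𝕜 C (ExteriorAlgebra.map f D) - ExteriorAlgebra.map f D = ExteriorAlgebra.map f X := by
    rw [gaussConv_map 𝕜 f C D, hX, map_sub]
  have hmap : ExteriorAlgebra.map g (ExteriorAlgebra.map f X) = ExteriorAlgebra.map (Matrix.toLin' (LinearMap.toMatrix' (g ∘ₗ f))) X := by
    rw [map_map_eq_map_comp, Matrix.toLin'_toMatrix']
  rw [hsub, hmap]
  -- the unweighted profile of `D` (`1 ≤ wt`)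
  have hDu : ∀ m' (j : Fin (2 * m')) (x : Γ'), ∑ Y ∈ univ.filter (fun Y : Fin (2 * m') → Γ' => Y j = x), ‖kernel 𝕜 D (2 * m') Y‖ ≤ ND m' :=
    fun m' j x => (sum_le_sum fun _ _ => le_mul_of_one_le_right (norm_nonneg _) (hwt.one_le _)).trans (hND m' j x)
  -- (global) the binomial–Gram door at the global profile, every pin
  have hglob : ∀ y' : Γ', ∑ Y' ∈ univ.filter (fun Y' : Fin (2 * q) → Γ' => Y' i = y'), ‖kernel 𝕜 X (2 * q) Y'‖ ≤ _ :=
    fun y' => sum_norm_kernel_gaussConv_sub_le_binomial_of_gramBounded C' hκ hGB D hD ND hND0 hDu i y'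
  -- (deep) the support-split composition at every near pin
  have hdeep : ∀ y' : Γ', Near y' → ∑ Y' ∈ univ.filter (fun Y' : Fin (2 * q) → Γ' => Y' i = y'), ‖kernel 𝕜 X (2 * q) Y'‖ ≤ _ :=
    fun y' hy' => sum_norm_kernel_gaussConv_sub_le_binomial_of_deep C' hwt hκ hGB D hD ND E hND0 hE0 hND P hE y' hΛ0 (hΛ y' hy') i
  -- nonnegativity of the two bounds
  have hE' := binomialRHS_nonneg hκ hE0 (Fintype.card Γ' / 2 + 1) q
  have hND' := binomialRHS_nonneg hκ hND0 (Fintype.card Γ' / 2 + 1) q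
  -- pushforward through `h = g ∘ f` at the output pin
  exact sum_pinned_norm_kernel_map_le_of_near_deg (LinearMap.toMatrix' (g ∘ₗ f)) X i w'' Near ha
    (add_nonneg hE' (mul_nonneg (inv_nonneg.2 hΛ0.le) hND')) hND' hcolH hrowH hτH hdeep hglob

/-! ## §2 Orders `≥ 2` (p700426) in a general output degree -/

/-- `…TwoVolumeLipDeepStep.sum_pinned_norm_kernel_map_incr_sub_incr_le_of_deep` restated in a general (positive) output degree `m` (factor `a^{m−1}`,
`ρ⁻¹^m`, leg constraint `m + 2(n−1) ≤ Σ2δ`); hypotheses verbatim. -/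
theorem sum_pinned_norm_kernel_map_incr_sub_incr_le_of_deep_deg
    {Γ : Type u} [Fintype Γ] [DecidableEq Γ] {Γ' : Type u} [Fintype Γ'] [DecidableEq Γ'] {Γ'' : Type*} [Fintype Γ''] [DecidableEq Γ'']
    {wt : Finset Γ' → ℝ} (hwt : IsTreeWeight wt) (C : Matrix Γ Γ 𝕜) (f : (Γ' → 𝕜) →ₗ[𝕜] (Γ → 𝕜)) (g : (Γ → 𝕜) →ₗ[𝕜] (Γ'' → 𝕜))
    {κ : ℝ} (hκ : 0 < κ) (hGB : IsGramBoundedR ((LinearMap.toMatrix' f).transpose * C * LinearMap.toMatrix' f) κ)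
    (V D : GrassmannAlgebra 𝕜 Γ') (hV : V ∈ evenPart 𝕜 Γ') (hD : D ∈ evenPart 𝕜 Γ') (hV0 : constPart 𝕜 V = 0) (hD0 : constPart 𝕜 D = 0)
    (NV ND E : ℕ → ℝ) (hNV0 : ∀ m', 0 ≤ NV m') (hND0 : ∀ m', 0 ≤ ND m') (hE0 : ∀ m', 0 ≤ E m')
    (hNV : ∀ m' (j : Fin (2 * m')) (x : Γ'), ∑ Y ∈ univ.filter (fun Y : Fin (2 * m') → Γ' => Y j = x),
      ‖kernel 𝕜 V (2 * m') Y‖ * wt (univ.image Y) ≤ NV m')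
    (hND : ∀ m' (j : Fin (2 * m')) (x : Γ'), ∑ Y ∈ univ.filter (fun Y : Fin (2 * m') → Γ' => Y j = x),
      ‖kernel 𝕜 D (2 * m') Y‖ * wt (univ.image Y) ≤ ND m')
    (P : Γ' → Prop) [DecidablePred P]
    (hE : ∀ m' (j : Fin (2 * m')) (x : Γ'), P x → ∑ Y ∈ univ.filter (fun Y : Fin (2 * m') → Γ' => Y j = x), ‖kernel 𝕜 D (2 * m') Y‖ ≤ E m')
    {α : ℝ} (hα : 0 < α)
    (hrow : ∀ X, ∑ Y, ‖((LinearMap.toMatrix' f).transpose * C * LinearMap.toMatrix' f) X Y‖ * wt {X, Y} ≤ α)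
    (hcol : ∀ Y, ∑ X, ‖((LinearMap.toMatrix' f).transpose * C * LinearMap.toMatrix' f) X Y‖ * wt {X, Y} ≤ α)
    {ρ : ℝ} (hρ : 0 < ρ)
    (hθ₁ : Real.exp 1 * α * normV Γ' κ ρ (fun m' => NV m' + ND m' + E m') / κ ^ 2 < 1)
    (hθ₂ : Real.exp 1 * α * normV Γ' κ ρ (fun m' => NV m' + ND m') / κ ^ 2 < 1)
    {N₀ : ℕ} (hN₀ : 2 ≤ N₀)
    (Near : Γ' → Prop) [DecidablePred Near] {a τ : ℝ} (ha : 0 ≤ a)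
    (hcolH : ∀ y', ∑ x'', ‖LinearMap.toMatrix' (g ∘ₗ f) x'' y'‖ ≤ a) (w'' : Γ'')
    (hrowH : ∑ y' ∈ univ.filter (fun y' : Γ' => Near y'), ‖LinearMap.toMatrix' (g ∘ₗ f) w'' y'‖ ≤ a)
    (hτH : ∑ y' ∈ univ.filter (fun y' : Γ' => ¬ Near y'), ‖LinearMap.toMatrix' (g ∘ₗ f) w'' y'‖ ≤ τ)
    {Λ : ℝ} (hΛ0 : 0 < Λ) (hΛ : ∀ y', Near y' → ∀ S : Finset Γ', y' ∈ S → (∃ z ∈ S, ¬ P z) → Λ ≤ wt S)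
    {m : ℕ} (p : Fin m) :
    ∑ X'' ∈ univ.filter (fun X'' : Fin m → Γ'' => X'' p = w''),
        ‖kernel 𝕜 (ExteriorAlgebra.map g
          ((effAction 𝕜 C (ExteriorAlgebra.map f (V + D)) - gaussConv 𝕜 C (ExteriorAlgebra.map f (V + D))) -
            (effAction 𝕜 C (ExteriorAlgebra.map f V) - gaussConv 𝕜 C (ExteriorAlgebra.map f V)))) m X''‖ ≤
      a ^ (m - 1) * (a *
        ((∑ n ∈ Ico 2 N₀, (ρ⁻¹ ^ m * κ⁻¹ ^ (2 * (n - 1)) * (α ^ (n - 1) * Real.exp n)) *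
            ∑ δ ∈ (Fintype.piFinset fun _ : Fin n => range (Fintype.card Γ' / 2 + 1)) with m + 2 * (n - 1) ≤ ∑ a, 2 * δ a,
              ∑ a, (Real.exp 2 * (κ + ρ)) ^ (2 * δ a) * E (δ a) *
                ∏ b ∈ univ.erase a, (Real.exp 2 * (κ + ρ)) ^ (2 * δ b) * (NV (δ b) + ND (δ b) + E (δ b)) +
          2 * (ρ⁻¹ ^ m * (Real.exp 1 * normV Γ' κ ρ (fun m' => NV m' + ND m' + E m')) *
            (Real.exp 1 * α * normV Γ' κ ρ (fun m' => NV m' + ND m' + E m') / κ ^ 2) ^ (N₀ - 1) /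
              (1 - Real.exp 1 * α * normV Γ' κ ρ (fun m' => NV m' + ND m' + E m') / κ ^ 2))) +
        Λ⁻¹ * (∑ n ∈ Ico 2 N₀, (ρ⁻¹ ^ m * κ⁻¹ ^ (2 * (n - 1)) * (α ^ (n - 1) * Real.exp n)) *
            ∑ δ ∈ (Fintype.piFinset fun _ : Fin n => range (Fintype.card Γ' / 2 + 1)) with m + 2 * (n - 1) ≤ ∑ a, 2 * δ a,
              ∑ a, (Real.exp 2 * (κ + ρ)) ^ (2 * δ a) * ND (δ a) *
                ∏ b ∈ univ.erase a, (Real.exp 2 * (κ + ρ)) ^ (2 * δ b) * (NV (δ b) + ND (δ b)) +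
          Λ * (2 * (ρ⁻¹ ^ m * (Real.exp 1 * normV Γ' κ ρ (fun m' => NV m' + ND m')) *
            (Real.exp 1 * α * normV Γ' κ ρ (fun m' => NV m' + ND m') / κ ^ 2) ^ (N₀ - 1) /
              (1 - Real.exp 1 * α * normV Γ' κ ρ (fun m' => NV m' + ND m') / κ ^ 2))))) +
        τ * (∑ n ∈ Ico 2 N₀, (ρ⁻¹ ^ m * κ⁻¹ ^ (2 * (n - 1)) * (α ^ (n - 1) * Real.exp n)) *
            ∑ δ ∈ (Fintype.piFinset fun _ : Fin n => range (Fintype.card Γ' / 2 + 1)) with m + 2 * (n - 1) ≤ ∑ a, 2 * δ a,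
              ∑ a, (Real.exp 2 * (κ + ρ)) ^ (2 * δ a) * ND (δ a) *
                ∏ b ∈ univ.erase a, (Real.exp 2 * (κ + ρ)) ^ (2 * δ b) * (NV (δ b) + ND (δ b)) +
          2 * (ρ⁻¹ ^ m * (Real.exp 1 * normV Γ' κ ρ (fun m' => NV m' + ND m')) *
            (Real.exp 1 * α * normV Γ' κ ρ (fun m' => NV m' + ND m') / κ ^ 2) ^ (N₀ - 1) /
              (1 - Real.exp 1 * α * normV Γ' κ ρ (fun m' => NV m' + ND m') / κ ^ 2)))) := by
  obtain ⟨r, rfl⟩ : ∃ r, m = r + 1 := ⟨m - 1, by have := p.pos; omega⟩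
  rw [Nat.add_sub_cancel]
  exact sum_pinned_norm_kernel_map_incr_sub_incr_le_of_deep hwt C f g hκ hGB V D hV hD hV0 hD0 NV ND E hNV0 hND0 hE0 hNV hND P hE hα hrow hcol
    hρ hθ₁ hθ₂ hN₀ Near ha hcolH w'' hrowH hτH hΛ0 hΛ p

/-! ## §3 The whole born difference at a deep pin: first order + orders `≥ 2` -/

/-- **THE DEEP BLOCK-STEP DOOR OF THE TWO-VOLUME LIPSCHITZ TOWER (`(f,g)`-reading, even output degree `2q`).**  Setting of
`sum_pinned_norm_kernel_map_incr_sub_incr_le_of_deep_deg`; born increments `born_C Y := effAction C Y − Y` of the two substituted inputs `map f (V+D)`,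
`map f V`.  Then
`Σ_{X″ : X″_i = w″} ‖kernel_{2q}(map g (born_C(map f (V+D)) − born_C(map f V)))(X″)‖ ≤ [first order: §1] + [orders ≥ 2: §2 at degree 2q]`
(triangle inequality on `born = (e^{Δ} − 1) + incr`).  This is the Grassmann-level `hstep` of T3-Lip₄ at one deep output pin, before the kit/units reading. -/
theorem sum_pinned_norm_kernel_map_born_sub_born_le_of_deep
    {Γ : Type u} [Fintype Γ] [DecidableEq Γ] {Γ' : Type u} [Fintype Γ'] [DecidableEq Γ'] {Γ'' : Type*} [Fintype Γ''] [DecidableEq Γ'']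
    {wt : Finset Γ' → ℝ} (hwt : IsTreeWeight wt) (C : Matrix Γ Γ 𝕜) (f : (Γ' → 𝕜) →ₗ[𝕜] (Γ → 𝕜)) (g : (Γ → 𝕜) →ₗ[𝕜] (Γ'' → 𝕜))
    {κ : ℝ} (hκ : 0 < κ) (hGB : IsGramBoundedR ((LinearMap.toMatrix' f).transpose * C * LinearMap.toMatrix' f) κ)
    (V D : GrassmannAlgebra 𝕜 Γ') (hV : V ∈ evenPart 𝕜 Γ') (hD : D ∈ evenPart 𝕜 Γ') (hV0 : constPart 𝕜 V = 0) (hD0 : constPart 𝕜 D = 0)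
    (NV ND E : ℕ → ℝ) (hNV0 : ∀ m', 0 ≤ NV m') (hND0 : ∀ m', 0 ≤ ND m') (hE0 : ∀ m', 0 ≤ E m')
    (hNV : ∀ m' (j : Fin (2 * m')) (x : Γ'), ∑ Y ∈ univ.filter (fun Y : Fin (2 * m') → Γ' => Y j = x),
      ‖kernel 𝕜 V (2 * m') Y‖ * wt (univ.image Y) ≤ NV m')
    (hND : ∀ m' (j : Fin (2 * m')) (x : Γ'), ∑ Y ∈ univ.filter (fun Y : Fin (2 * m') → Γ' => Y j = x),
      ‖kernel 𝕜 D (2 * m') Y‖ * wt (univ.image Y) ≤ ND m')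
    (P : Γ' → Prop) [DecidablePred P]
    (hE : ∀ m' (j : Fin (2 * m')) (x : Γ'), P x → ∑ Y ∈ univ.filter (fun Y : Fin (2 * m') → Γ' => Y j = x), ‖kernel 𝕜 D (2 * m') Y‖ ≤ E m')
    {α : ℝ} (hα : 0 < α)
    (hrow : ∀ X, ∑ Y, ‖((LinearMap.toMatrix' f).transpose * C * LinearMap.toMatrix' f) X Y‖ * wt {X, Y} ≤ α)
    (hcol : ∀ Y, ∑ X, ‖((LinearMap.toMatrix' f).transpose * C * LinearMap.toMatrix' f) X Y‖ * wt {X, Y} ≤ α)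
    {ρ : ℝ} (hρ : 0 < ρ)
    (hθ₁ : Real.exp 1 * α * normV Γ' κ ρ (fun m' => NV m' + ND m' + E m') / κ ^ 2 < 1)
    (hθ₂ : Real.exp 1 * α * normV Γ' κ ρ (fun m' => NV m' + ND m') / κ ^ 2 < 1)
    {N₀ : ℕ} (hN₀ : 2 ≤ N₀)
    (Near : Γ' → Prop) [DecidablePred Near] {a τ : ℝ} (ha : 0 ≤ a)
    (hcolH : ∀ y', ∑ x'', ‖LinearMap.toMatrix' (g ∘ₗ f) x'' y'‖ ≤ a) (w'' : Γ'')
    (hrowH : ∑ y' ∈ univ.filter (fun y' : Γ' => Near y'), ‖LinearMap.toMatrix' (g ∘ₗ f) w'' y'‖ ≤ a)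
    (hτH : ∑ y' ∈ univ.filter (fun y' : Γ' => ¬ Near y'), ‖LinearMap.toMatrix' (g ∘ₗ f) w'' y'‖ ≤ τ)
    {Λ : ℝ} (hΛ0 : 0 < Λ) (hΛ : ∀ y', Near y' → ∀ S : Finset Γ', y' ∈ S → (∃ z ∈ S, ¬ P z) → Λ ≤ wt S)
    {q : ℕ} (i : Fin (2 * q)) :
    ∑ X'' ∈ univ.filter (fun X'' : Fin (2 * q) → Γ'' => X'' i = w''),
        ‖kernel 𝕜 (ExteriorAlgebra.map g
          ((effAction 𝕜 C (ExteriorAlgebra.map f (V + D)) - ExteriorAlgebra.map f (V + D)) -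
            (effAction 𝕜 C (ExteriorAlgebra.map f V) - ExteriorAlgebra.map f V))) (2 * q) X''‖ ≤
      a ^ (2 * q - 1) * (a *
        ((∑ m' ∈ range (Fintype.card Γ' / 2 + 1), if q < m' then ((2 * m').choose (2 * q) : ℝ) * κ ^ (2 * m' - 2 * q) * E m' else 0) +
          Λ⁻¹ * ∑ m' ∈ range (Fintype.card Γ' / 2 + 1),
            if q < m' then ((2 * m').choose (2 * q) : ℝ) * κ ^ (2 * m' - 2 * q) * ND m' else 0) +
        τ * ∑ m' ∈ range (Fintype.card Γ' / 2 + 1), if q < m' then ((2 * m').choose (2 * q) : ℝ) * κ ^ (2 * m' - 2 * q) * ND m' else 0) +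
      a ^ (2 * q - 1) * (a *
        ((∑ n ∈ Ico 2 N₀, (ρ⁻¹ ^ (2 * q) * κ⁻¹ ^ (2 * (n - 1)) * (α ^ (n - 1) * Real.exp n)) *
            ∑ δ ∈ (Fintype.piFinset fun _ : Fin n => range (Fintype.card Γ' / 2 + 1)) with 2 * q + 2 * (n - 1) ≤ ∑ a, 2 * δ a,
              ∑ a, (Real.exp 2 * (κ + ρ)) ^ (2 * δ a) * E (δ a) *
                ∏ b ∈ univ.erase a, (Real.exp 2 * (κ + ρ)) ^ (2 * δ b) * (NV (δ b) + ND (δ b) + E (δ b)) +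
          2 * (ρ⁻¹ ^ (2 * q) * (Real.exp 1 * normV Γ' κ ρ (fun m' => NV m' + ND m' + E m')) *
            (Real.exp 1 * α * normV Γ' κ ρ (fun m' => NV m' + ND m' + E m') / κ ^ 2) ^ (N₀ - 1) /
              (1 - Real.exp 1 * α * normV Γ' κ ρ (fun m' => NV m' + ND m' + E m') / κ ^ 2))) +
        Λ⁻¹ * (∑ n ∈ Ico 2 N₀, (ρ⁻¹ ^ (2 * q) * κ⁻¹ ^ (2 * (n - 1)) * (α ^ (n - 1) * Real.exp n)) *
            ∑ δ ∈ (Fintype.piFinset fun _ : Fin n => range (Fintype.card Γ' / 2 + 1)) with 2 * q + 2 * (n - 1) ≤ ∑ a, 2 * δ a,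
              ∑ a, (Real.exp 2 * (κ + ρ)) ^ (2 * δ a) * ND (δ a) *
                ∏ b ∈ univ.erase a, (Real.exp 2 * (κ + ρ)) ^ (2 * δ b) * (NV (δ b) + ND (δ b)) +
          Λ * (2 * (ρ⁻¹ ^ (2 * q) * (Real.exp 1 * normV Γ' κ ρ (fun m' => NV m' + ND m')) *
            (Real.exp 1 * α * normV Γ' κ ρ (fun m' => NV m' + ND m') / κ ^ 2) ^ (N₀ - 1) /
              (1 - Real.exp 1 * α * normV Γ' κ ρ (fun m' => NV m' + ND m') / κ ^ 2))))) +
        τ * (∑ n ∈ Ico 2 N₀, (ρ⁻¹ ^ (2 * q) * κ⁻¹ ^ (2 * (n - 1)) * (α ^ (n - 1) * Real.exp n)) *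
            ∑ δ ∈ (Fintype.piFinset fun _ : Fin n => range (Fintype.card Γ' / 2 + 1)) with 2 * q + 2 * (n - 1) ≤ ∑ a, 2 * δ a,
              ∑ a, (Real.exp 2 * (κ + ρ)) ^ (2 * δ a) * ND (δ a) *
                ∏ b ∈ univ.erase a, (Real.exp 2 * (κ + ρ)) ^ (2 * δ b) * (NV (δ b) + ND (δ b)) +
          2 * (ρ⁻¹ ^ (2 * q) * (Real.exp 1 * normV Γ' κ ρ (fun m' => NV m' + ND m')) *
            (Real.exp 1 * α * normV Γ' κ ρ (fun m' => NV m' + ND m') / κ ^ 2) ^ (N₀ - 1) /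
              (1 - Real.exp 1 * α * normV Γ' κ ρ (fun m' => NV m' + ND m') / κ ^ 2)))) := by
  -- `born = (e^{Δ} − 1) + incr`, and the first order is linear in the input
  have hfVD : ExteriorAlgebra.map f (V + D) = ExteriorAlgebra.map f V + ExteriorAlgebra.map f D := map_add _ _ _
  have hgc : gaussConv 𝕜 C (ExteriorAlgebra.map f V + ExteriorAlgebra.map f D) =
      gaussConv 𝕜 C (ExteriorAlgebra.map f V) + gaussConv 𝕜 C (ExteriorAlgebra.map f D) := map_add _ _ _
  have halg : (effAction 𝕜 C (ExteriorAlgebra.map f (V + D)) - ExteriorAlgebra.map f (V + D)) -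
      (effAction 𝕜 C (ExteriorAlgebra.map f V) - ExteriorAlgebra.map f V) =
      (gaussConv 𝕜 C (ExteriorAlgebra.map f D) - ExteriorAlgebra.map f D) +
        ((effAction 𝕜 C (ExteriorAlgebra.map f (V + D)) - gaussConv 𝕜 C (ExteriorAlgebra.map f (V + D))) -
          (effAction 𝕜 C (ExteriorAlgebra.map f V) - gaussConv 𝕜 C (ExteriorAlgebra.map f V))) := by
    rw [hfVD, hgc]; abel
  have h1 := sum_pinned_norm_kernel_map_gaussConv_sub_le_of_deep hwt C f g hκ.le hGB D hD ND E hND0 hE0 hND P hE Near ha hcolH w'' hrowH hτH hΛ0 hΛ i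
  have h2 := sum_pinned_norm_kernel_map_incr_sub_incr_le_of_deep_deg hwt C f g hκ hGB V D hV hD hV0 hD0 NV ND E hNV0 hND0 hE0 hNV hND P hE hα hrow
    hcol hρ hθ₁ hθ₂ hN₀ Near ha hcolH w'' hrowH hτH hΛ0 hΛ i
  calc ∑ X'' ∈ univ.filter (fun X'' : Fin (2 * q) → Γ'' => X'' i = w''),
        ‖kernel 𝕜 (ExteriorAlgebra.map g
          ((effAction 𝕜 C (ExteriorAlgebra.map f (V + D)) - ExteriorAlgebra.map f (V + D)) -
            (effAction 𝕜 C (ExteriorAlgebra.map f V) - ExteriorAlgebra.map f V))) (2 * q) X''‖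
      ≤ ∑ X'' ∈ univ.filter (fun X'' : Fin (2 * q) → Γ'' => X'' i = w''),
          (‖kernel 𝕜 (ExteriorAlgebra.map g (gaussConv 𝕜 C (ExteriorAlgebra.map f D) - ExteriorAlgebra.map f D)) (2 * q) X''‖ +
            ‖kernel 𝕜 (ExteriorAlgebra.map g
              ((effAction 𝕜 C (ExteriorAlgebra.map f (V + D)) - gaussConv 𝕜 C (ExteriorAlgebra.map f (V + D))) -
                (effAction 𝕜 C (ExteriorAlgebra.map f V) - gaussConv 𝕜 C (ExteriorAlgebra.map f V)))) (2 * q) X''‖) := by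
        refine sum_le_sum fun X'' _ => ?_
        rw [halg, map_add, kernel_add]
        exact norm_add_le _ _
    _ ≤ _ := by rw [sum_add_distrib]; exact add_le_add h1 h2

end Summit.HubbardSuperconductivity.HubbardSuperconductivity.Theorems.TwoVolumeDefect

end
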